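import Summits.QuantumFields.YangMills.Theorems.BalabanUVNodesN12GaugeLetterLocAtRecordLocal
import Summits.QuantumFields.YangMills.Theorems.BalabanUVNodesN12GaugeLetterLocOfPlaqSmall
import HarnessLib

/-!
# BalabanUVNodes ∕ N12 — THE FREE-`ε` (σ)_N EDITIONS WITH LOCAL DATUM ∕ SHADOW LETTERS: `N12GaugeLetterLocOfPlaqSmall` re-derived on the local capstone `N12GaugeLetterLocAtRecordLocal` —
# the datum letter `hWj` and the shadow geometry `hGmem` are asked only for the members of `𝐁_k(Z)` within walk-distance `ℓ_k + m·L^k` of `Ω₁(Z)` (inhabitable from a bounded region box),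
# not for all of `bondsOf (Ω₁ᶜ)`

Cell `pub-ymgap` (HUMAN RULINGS D-0062 ∕ D-0149), WIDTH SEAT `pub-ymgap-dag-n12-w3` g4 (node N12 = [B15]; key K1⁹ `stmt-QuantumFields-27364` (KEY MAP v2), `--kind proof --supports … --as
helper`; count-neutral).  THEOREMS ONLY (0 `def`, 0 `instance`, 0 `sorry`); composition by name (honest flag of 2026-08-28: the global letters are uninhabitable far from `Z` when `W = ext Vk`).

★★ `datumLetter_of_shadows_local` (any `X`, `R`); ★★ `exists_gaugeLetterLoc_atRecord_of_supportSmall_local`; ★★★ `exists_gaugeLetterLoc_atRecord_of_plaqSmall_geometry_local` — RESIDUE: the minimiser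
`hmin`, the graded bound `hU` (free `ε > 0`, [Balaban1985Variational] Thm 1's output shape), the region datum `W 𝒞 ρn`, the region geometry `hGN` ∕ `hN1` (dag-n12-w6) and the LOCAL shadow
geometry `hGmem`, budgets `θ`, numerics.  The explicit corner (budgets chosen, numerics folded; class corollary) is the next file.

HONEST FRAMING.  Composition by name; every displayed letter stays a HYPOTHESIS; nothing of Bałaban's asserted beyond cited tree theorems; count-neutral; N12 NOT discharged; K1⁹ NOT closed;
counts unmoved (typed 28∕28 · discharged 5∕27); one finite 𝕋⁴ programme at fixed ε — R4 closes the conditional rung `BalabanLadder.UV` only; SCALING in `L` is the scale-0 one (crude); the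
Yang–Mills mass gap (Clay) is NOT proved by any of this; nothing continuum ∕ ℝ⁴ ∕ OS.
-/

noncomputable section

open scoped Matrix.Norms.L2Operator BigOperators

namespace Summit.QuantumFields.YangMills.BalabanUVNodes.N12GaugeLetterLocOfPlaqSmallLocal

open Literature.MathematicalPhysics.QuantumFieldTheory.Balaban1983to89
open T4Continuum GaugeField B15DeterminingSets BlockAveraging
open T4CubeChartGnomonic (SU2)
open B16Sect1Backgrounds (toMS)
open T4AxialGaugeSmallField (boxPlaqs castSite)
open B14.Eq213MaximalDomains (side)
open B14.Eq213DetSet (Bj maxDomT maxDomT_antitone dist_maxDomT)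
open B14.Eq216Concrete (inputs)
open B14.Eq22Determines (blockIter)
open B14DomainGeom (Within)
open B15Eq112TorusCover (cover lift cover_lift cover_apply)
open B5Eq118OneStroke (iterBlockOf)
open B7Prop1Explicit (e e_apply)
open B8Eq17ClassAkV1 (plaqsOf)
open ExpMeanLog (deltaSU)
open Literature.MathematicalPhysics.QuantumFieldTheory.BalabanImbrieJaffe1984to88.BIJ85Eq453GaugeField (qsstarGIter0)
open Summit.QuantumFields.YangMills.BalabanUVNodes.N20LCSAvgDominationRegion (boxRegion)
open Summit.QuantumFields.YangMills.Theorems.BalabanUVNodesN11LocalIteratedAveraging (plaqSmallOn_iter_avOfRecord_of_boxClosed)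
open Summit.QuantumFields.YangMills.BalabanUVNodes.N12BjCollarRoots (le_of_iterBlockOf_mem_Bj mem_maxDomT_of_iterBlockOf_mem_Bj)
open Summit.QuantumFields.YangMills.BalabanUVNodes.N12BjRootChainsGraded (exists_chain_centre_centre_graded)
open Summit.QuantumFields.YangMills.BalabanUVNodes.N12GaugeLetterLocAtRecordLocal (exists_gaugeLetterLoc_atRecord_local)
open Summit.QuantumFields.YangMills.BalabanUVNodes.N12GaugeLetterLocOfClass (exists_cover_of_mem_boxPlaqs boxPlaqs_src_mem_hullD)
open B15Prop1MinimiserTowerAxialGauge (dist1_avgFamily_avOfRecord_qsstarGIter0_le)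
open B15Prop1DatumSmall7AtZSequence (blockIter_add_embIter)
open Summit.QuantumFields.YangMills.BalabanUVNodes.N12GaugeLetterLocOfPlaqSmall (iteratedPlaqLetter_of_family_of_plaqSmall)
open Summit.QuantumFields.YangMills.BalabanUVNodes.N12SegmentPlaqFamilyAtRecord (exists_segmentPlaqFamily_Bj)

variable {P : Params}

/-! ## §1 The local datum letter from the local shadow geometry -/

/-- ★★ **THE LOCAL DATUM LETTER FROM THE LOCAL SHADOW GEOMETRY** — `N12DatumLetterOfShadows.datumLetter_of_shadows` with both sides restricted to the members `c` of `𝔹_i` one of whose segment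
ends `ι_i c∓` is reached from a point of `X` by a fine word of length `≤ R` (at the record: `X = Ω₁(Z)`, `R = ℓ_k + m·L^k`).
[cite: Balaban1988Convergent, (2.16) p.257, p.267 L5–7; Balaban1989LargeFieldI, p.193 L14–16; Balaban1987RG1, (0.1) p.251] -/
theorem datumLetter_of_shadows_local {F : T4Family} {N : ℕ} [NeZero N] (Kt : ℕ) {k : ℕ} (hk : k ≤ (F.P Kt).m + (F.P Kt).K) (𝔹 : DetSet (F.P Kt))
    (W : GaugeField (F.P Kt) k (Node00.SU N)) {𝒞 : Set (PBond (F.P Kt) k)} {ρn : ℝ} (hρn : 0 ≤ ρn) (hD : ∀ c ∈ 𝒞, dist1 (W c) ≤ ρn)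
    (X : Set (Site (F.P Kt) 0)) (R : ℕ)
    (hGmem : ∀ x ∈ X, ∀ i ≤ k, ∀ c ∈ bondsOf (𝔹 i),
      (∃ w : List (Letter (F.P Kt).d), w.length ≤ R ∧ (walkEnd x w = embIter i c.src ∨ walkEnd x w = embIter i c.tgt)) →
      blockIter k (embIter i c.tgt) ≠ blockIter k (embIter i c.src) → (⟨blockIter k (embIter i c.src), c.dir⟩ : PBond (F.P Kt) k) ∈ 𝒞) :
    ∀ x ∈ X, ∀ i ≤ k, ∀ c ∈ bondsOf (𝔹 i),
      (∃ w : List (Letter (F.P Kt).d), w.length ≤ R ∧ (walkEnd x w = embIter i c.src ∨ walkEnd x w = embIter i c.tgt)) →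
      dist1 (avgFamily (Node00.avOfRecord F N Kt) (qsstarGIter0 k W) i c) ≤ ρn := by
  intro x hx i hi c hc hw
  obtain ⟨n, rfl⟩ := Nat.exists_eq_add_of_le hi
  have hG := hGmem x hx i hi c hc hw
  rw [blockIter_add_embIter i n hk c.tgt, blockIter_add_embIter i n hk c.src] at hG
  exact dist1_avgFamily_avOfRecord_qsstarGIter0_le Kt hk W hρn c fun hne => hD _ (hG hne)

/-! ## §2 The capstone from a support-level plaquette bound, local datum letter -/

/-- ★★ **(σ)_N FROM A SUPPORT-LEVEL PLAQUETTE BOUND, LOCAL DATUM LETTER** — `N12GaugeLetterLocOfPlaqSmall.exists_gaugeLetterLoc_atRecord_of_supportSmall` on the local capstone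
`N12GaugeLetterLocAtRecordLocal.exists_gaugeLetterLoc_atRecord_local`: `hWj` asked only within walk-distance `ℓ_k + m·L^k` of `Ω₁(Z)`.
[cite: Balaban1985Variational, (2)–(4) p.278, Thm 1 p.280; Balaban1988Convergent, (2.12)–(2.13) pp.256–257, (2.16) p.257; Balaban1987RG1, (0.4) p.253] -/
theorem exists_gaugeLetterLoc_atRecord_of_supportSmall_local {F : T4Family} (ν : Node00.Stage7Numerics) (Kt : ℕ) {k : ℕ} (hk0 : 0 < k) (hk : k ≤ (F.P Kt).m + (F.P Kt).K)
    (hM2 : 2 ≤ ν.M₁) (hdiv : side (F.P Kt).L ν.M₁ k ∣ (F.P Kt).sitesPerDir 0) (Z : Set (Site (F.P Kt) 0))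
    -- no wrapping, at the caps `ℓ_k`, `m·L^k`
    (hN : 2 * (∑ i ∈ Finset.range (k + 1), ((F.P Kt).d * (((F.P Kt).L ^ i - 1) / 2) + 1)) + 1 +
      (3 * ((F.P Kt).d * (((F.P Kt).L - 1) / 2)) + 5) * (F.P Kt).L ^ k < (F.P Kt).sitesPerDir 0)
    -- radius numerics: the level-`J` box fits the collar `L^{J−1}·M₁`
    (hRad : ∀ J, 1 ≤ J → J ≤ k →
      (2 * ∑ i ∈ Finset.range (J + 1 + 1), ((F.P Kt).d * (((F.P Kt).L ^ i - 1) / 2) + 1)) + 1 +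
          (3 * ((F.P Kt).d * (((F.P Kt).L - 1) / 2)) + 5) * (F.P Kt).L ^ min (J + 1) k +
        (∑ i ∈ Finset.range (J + 1), ((F.P Kt).d * (((F.P Kt).L ^ i - 1) / 2) + 1)) + 3 ≤ (F.P Kt).L ^ (J - 1) * ν.M₁)
    -- the region-normalised datum and the minimiser
    {ρn : ℝ} (hρn : 0 ≤ ρn)
    (W : GaugeField (F.P Kt) k SU2) (𝒞 : Set (PBond (F.P Kt) k)) (hD : ∀ c ∈ 𝒞, dist1 (W c) ≤ ρn)
    {U₀ : GaugeField (F.P Kt) 0 SU2}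
    (hmin : IsMinimizer (Node00.avOfRecord F 2 Kt) (Node00.regMSCoPOfRecord F 2 ν Kt k (maxDomT ν.M₁ Z)) (Bj ν.M₁ Z k)
      (avgFamily (Node00.avOfRecord F 2 Kt) (qsstarGIter0 k W)) U₀)
    -- DISPLAYED: the plaquettes of `U₀` on the support `Ω₀` are `εP`-small (the class at scale 0: `εP = εreg·η₀²`; [15] Thm 1: `εP = B₃·δ₀·η₀²`)
    {εP : ℝ} (hεP : 0 ≤ εP) (hP : PlaqSmallOn (plaqsOf (Node00.suppDomOfRecord F ν Kt (maxDomT ν.M₁ Z))) εP U₀)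
    -- geometry of the neighbourhood (dag-n12-w6's letters, verbatim)
    (N : Set (PBond (F.P Kt) 0))
    (hGN : ∀ b ∈ N, (b.src ∉ maxDomT ν.M₁ Z 1 ∨ b.tgt ∉ maxDomT ν.M₁ Z 1) → blockIter k b.tgt ≠ blockIter k b.src →
      (⟨blockIter k b.src, b.dir⟩ : PBond (F.P Kt) k) ∈ 𝒞)
    (hN1 : ∀ p : Plaq (F.P Kt) 0, ((⟨p.src, p.μ⟩ : PBond (F.P Kt) 0) ∈ {b : PBond (F.P Kt) 0 | b.src ∈ maxDomT ν.M₁ Z 1} ∨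
        (⟨p.src.shift p.μ, p.ν⟩ : PBond (F.P Kt) 0) ∈ {b : PBond (F.P Kt) 0 | b.src ∈ maxDomT ν.M₁ Z 1} ∨
        (⟨p.src.shift p.ν, p.μ⟩ : PBond (F.P Kt) 0) ∈ {b : PBond (F.P Kt) 0 | b.src ∈ maxDomT ν.M₁ Z 1} ∨
        (⟨p.src, p.ν⟩ : PBond (F.P Kt) 0) ∈ {b : PBond (F.P Kt) 0 | b.src ∈ maxDomT ν.M₁ Z 1}) →
      (⟨p.src, p.μ⟩ : PBond (F.P Kt) 0) ∈ N ∧ (⟨p.src.shift p.μ, p.ν⟩ : PBond (F.P Kt) 0) ∈ N ∧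
        (⟨p.src.shift p.ν, p.μ⟩ : PBond (F.P Kt) 0) ∈ N ∧ (⟨p.src, p.ν⟩ : PBond (F.P Kt) 0) ∈ N)
    -- DISPLAYED: the plaquette letter on the iterated averages near the member segments, with its budgets
    (a θ : ℕ → ℝ) (hθ0 : 0 ≤ θ 0) (ha0 : ∀ j, 0 ≤ a j)
    (haN : ∀ j < k, (((((F.P Kt).d + 2) * (F.P Kt).L : ℕ) : ℝ) ^ 2 / 4) * a j < deltaSU (Fin 2))
    (hθ : ∀ j, 6 * ((((((F.P Kt).d + 2) * (F.P Kt).L : ℕ) : ℝ) ^ 2 / 4) * a j) + (F.P Kt).L * θ j ≤ θ (j + 1))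
    (ha : ∀ i ≤ k, ∀ c ∈ bondsOf ((Bj ν.M₁ Z k : DetSet (F.P Kt)) i), ∀ j < i, ∀ c' : PBond (F.P Kt) (j + 1), c'.dir = c.dir →
      (∃ s < (F.P Kt).L ^ i, embIter (j + 1) c'.src = (fun z : Site (F.P Kt) 0 => z.shift c.dir)^[s] (embIter i c.src)) →
      ∀ q : Plaq (F.P Kt) j, (blockOf q.src = c'.src.unshift c'.dir ∨ blockOf q.src = c'.src ∨ blockOf q.src = c'.tgt) →
        dist1 (GaugeField.plaqHol (avgFamily (Node00.avOfRecord F 2 Kt) U₀ j) q) < a j)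
    -- DISPLAYED: the datum letter at the members (levels `≤ k`)
    {δ₁ : ℝ} (hδ0 : 0 ≤ δ₁)
    (hWj : ∀ x ∈ maxDomT ν.M₁ Z 1, ∀ i ≤ k, ∀ c ∈ bondsOf ((Bj ν.M₁ Z k : DetSet (F.P Kt)) i),
      (∃ w : List (Letter (F.P Kt).d), w.length ≤ (∑ i ∈ Finset.range (k + 1), ((F.P Kt).d * (((F.P Kt).L ^ i - 1) / 2) + 1)) + (3 * ((F.P Kt).d * (((F.P Kt).L - 1) / 2)) + 5) * (F.P Kt).L ^ k ∧
        (walkEnd x w = embIter i c.src ∨ walkEnd x w = embIter i c.tgt)) →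
      dist1 (avgFamily (Node00.avOfRecord F 2 Kt) (qsstarGIter0 k W) i c) ≤ δ₁) :
    ∃ σ : GaugeTransf (F.P Kt) 0 SU2,
      (∀ j, j ≤ k → ∀ b ∈ bondsOf (Bj ν.M₁ Z k j), toMS σ j b.src = 1 ∧ toMS σ j b.tgt = 1) ∧
        (∀ p : Plaq (F.P Kt) 0, ((⟨p.src, p.μ⟩ : PBond (F.P Kt) 0) ∈ {b : PBond (F.P Kt) 0 | b.src ∈ maxDomT ν.M₁ Z 1} ∨
            (⟨p.src.shift p.μ, p.ν⟩ : PBond (F.P Kt) 0) ∈ {b : PBond (F.P Kt) 0 | b.src ∈ maxDomT ν.M₁ Z 1} ∨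
            (⟨p.src.shift p.ν, p.μ⟩ : PBond (F.P Kt) 0) ∈ {b : PBond (F.P Kt) 0 | b.src ∈ maxDomT ν.M₁ Z 1} ∨
            (⟨p.src, p.ν⟩ : PBond (F.P Kt) 0) ∈ {b : PBond (F.P Kt) 0 | b.src ∈ maxDomT ν.M₁ Z 1}) →
          ‖((gaugeAct σ U₀ ⟨p.src, p.μ⟩ : SU2) : Matrix (Fin 2) (Fin 2) ℂ) - 1‖ ≤
              max ρn ((((2 * (∑ i ∈ Finset.range (k + 1), ((F.P Kt).d * (((F.P Kt).L ^ i - 1) / 2) + 1)) + 1 +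
                  (3 * ((F.P Kt).d * (((F.P Kt).L - 1) / 2)) + 5) * (F.P Kt).L ^ k : ℕ) : ℝ)) ^ 2 / 4 * εP +
                ((3 * ((F.P Kt).d * (((F.P Kt).L - 1) / 2)) + 5 : ℕ) : ℝ) * θ k + ((3 * ((F.P Kt).d * (((F.P Kt).L - 1) / 2)) + 5 : ℕ) : ℝ) * δ₁) ∧
            ‖((gaugeAct σ U₀ ⟨p.src.shift p.μ, p.ν⟩ : SU2) : Matrix (Fin 2) (Fin 2) ℂ) - 1‖ ≤
              max ρn ((((2 * (∑ i ∈ Finset.range (k + 1), ((F.P Kt).d * (((F.P Kt).L ^ i - 1) / 2) + 1)) + 1 +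
                  (3 * ((F.P Kt).d * (((F.P Kt).L - 1) / 2)) + 5) * (F.P Kt).L ^ k : ℕ) : ℝ)) ^ 2 / 4 * εP +
                ((3 * ((F.P Kt).d * (((F.P Kt).L - 1) / 2)) + 5 : ℕ) : ℝ) * θ k + ((3 * ((F.P Kt).d * (((F.P Kt).L - 1) / 2)) + 5 : ℕ) : ℝ) * δ₁) ∧
            ‖((gaugeAct σ U₀ ⟨p.src.shift p.ν, p.μ⟩ : SU2) : Matrix (Fin 2) (Fin 2) ℂ) - 1‖ ≤
              max ρn ((((2 * (∑ i ∈ Finset.range (k + 1), ((F.P Kt).d * (((F.P Kt).L ^ i - 1) / 2) + 1)) + 1 +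
                  (3 * ((F.P Kt).d * (((F.P Kt).L - 1) / 2)) + 5) * (F.P Kt).L ^ k : ℕ) : ℝ)) ^ 2 / 4 * εP +
                ((3 * ((F.P Kt).d * (((F.P Kt).L - 1) / 2)) + 5 : ℕ) : ℝ) * θ k + ((3 * ((F.P Kt).d * (((F.P Kt).L - 1) / 2)) + 5 : ℕ) : ℝ) * δ₁) ∧
            ‖((gaugeAct σ U₀ ⟨p.src, p.ν⟩ : SU2) : Matrix (Fin 2) (Fin 2) ℂ) - 1‖ ≤
              max ρn ((((2 * (∑ i ∈ Finset.range (k + 1), ((F.P Kt).d * (((F.P Kt).L ^ i - 1) / 2) + 1)) + 1 +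
                  (3 * ((F.P Kt).d * (((F.P Kt).L - 1) / 2)) + 5) * (F.P Kt).L ^ k : ℕ) : ℝ)) ^ 2 / 4 * εP +
                ((3 * ((F.P Kt).d * (((F.P Kt).L - 1) / 2)) + 5 : ℕ) : ℝ) * θ k + ((3 * ((F.P Kt).d * (((F.P Kt).L - 1) / 2)) + 5 : ℕ) : ℝ) * δ₁)) ∧
        (∀ b ∈ inputs (Bj ν.M₁ Z k), b ∈ N →
          ‖((gaugeAct σ U₀ b : SU2) : Matrix (Fin 2) (Fin 2) ℂ) - 1‖ ≤
              max ρn ((((2 * (∑ i ∈ Finset.range (k + 1), ((F.P Kt).d * (((F.P Kt).L ^ i - 1) / 2) + 1)) + 1 +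
                  (3 * ((F.P Kt).d * (((F.P Kt).L - 1) / 2)) + 5) * (F.P Kt).L ^ k : ℕ) : ℝ)) ^ 2 / 4 * εP +
                ((3 * ((F.P Kt).d * (((F.P Kt).L - 1) / 2)) + 5 : ℕ) : ℝ) * θ k + ((3 * ((F.P Kt).d * (((F.P Kt).L - 1) / 2)) + 5 : ℕ) : ℝ) * δ₁)) := by
  have hM : 1 ≤ ν.M₁ := by omega
  have hk1 : 1 ≤ k := hk0
  -- the sums `ℓ_J` grow with `J`
  have hℓmono : ∀ {a b : ℕ}, a ≤ b → ∑ i ∈ Finset.range (a + 1), ((F.P Kt).d * (((F.P Kt).L ^ i - 1) / 2) + 1) ≤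
      ∑ i ∈ Finset.range (b + 1), ((F.P Kt).d * (((F.P Kt).L ^ i - 1) / 2) + 1) := fun {a b} hab => by
    apply Finset.sum_le_sum_of_subset
    intro i hi
    simp only [Finset.mem_range] at hi ⊢
    omega
  -- the graded boxes lie in the support
  have hSΩ : ∀ b : PBond (F.P Kt) 0, b.src ∈ maxDomT ν.M₁ Z 1 → b.tgt ∈ maxDomT ν.M₁ Z 1 →
      ∀ J J' : ℕ, iterBlockOf J b.src ∈ (Bj ν.M₁ Z k : DetSet (F.P Kt)) J → iterBlockOf J' b.tgt ∈ (Bj ν.M₁ Z k : DetSet (F.P Kt)) J' →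
      (boxPlaqs
          (fun κ => ((b.src κ).val : ℤ) -
            (((2 * max (∑ i ∈ Finset.range (J + 1), ((F.P Kt).d * (((F.P Kt).L ^ i - 1) / 2) + 1))
                  (∑ i ∈ Finset.range (J' + 1), ((F.P Kt).d * (((F.P Kt).L ^ i - 1) / 2) + 1)) + 1 +
                (3 * ((F.P Kt).d * (((F.P Kt).L - 1) / 2)) + 5) * (F.P Kt).L ^ min (J + 1) k) +
              ∑ i ∈ Finset.range (J + 1), ((F.P Kt).d * (((F.P Kt).L ^ i - 1) / 2) + 1) : ℕ) : ℤ))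
          (fun κ => ((b.src κ).val : ℤ) +
            (((2 * max (∑ i ∈ Finset.range (J + 1), ((F.P Kt).d * (((F.P Kt).L ^ i - 1) / 2) + 1))
                  (∑ i ∈ Finset.range (J' + 1), ((F.P Kt).d * (((F.P Kt).L ^ i - 1) / 2) + 1)) + 1 +
                (3 * ((F.P Kt).d * (((F.P Kt).L - 1) / 2)) + 5) * (F.P Kt).L ^ min (J + 1) k) +
              ∑ i ∈ Finset.range (J + 1), ((F.P Kt).d * (((F.P Kt).L ^ i - 1) / 2) + 1) : ℕ) : ℤ) + 2) : Set (Plaq (F.P Kt) 0)) ⊆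
        plaqsOf (Node00.suppDomOfRecord F ν Kt (maxDomT ν.M₁ Z)) := by
    intro b hbs hbt J J' hJ hJ' p hp
    -- the levels: `1 ≤ J ≤ k`, `J' ≤ J + 1`
    have hJk : J ≤ k := le_of_iterBlockOf_mem_Bj hJ
    have hJ1 : 1 ≤ J := by
      by_contra h
      have hJ0 : J = 0 := by omega
      subst hJ0
      rw [B14.Eq213DetSet.Bj_zero (by omega)] at hJ
      exact hJ hbs
    obtain ⟨⟨-, hJ'le⟩, -⟩ := exists_chain_centre_centre_graded hM2 hdiv hk b hJ1 hJ hJ'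
    have hxΩ : b.src ∈ maxDomT ν.M₁ Z J := mem_maxDomT_of_iterBlockOf_mem_Bj hM hdiv hk hJ1 hJ
    -- the radius is at most `R(J)`
    set R : ℕ := (2 * max (∑ i ∈ Finset.range (J + 1), ((F.P Kt).d * (((F.P Kt).L ^ i - 1) / 2) + 1))
          (∑ i ∈ Finset.range (J' + 1), ((F.P Kt).d * (((F.P Kt).L ^ i - 1) / 2) + 1)) + 1 +
        (3 * ((F.P Kt).d * (((F.P Kt).L - 1) / 2)) + 5) * (F.P Kt).L ^ min (J + 1) k) +
      ∑ i ∈ Finset.range (J + 1), ((F.P Kt).d * (((F.P Kt).L ^ i - 1) / 2) + 1) with hRdef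
    have hmax : max (∑ i ∈ Finset.range (J + 1), ((F.P Kt).d * (((F.P Kt).L ^ i - 1) / 2) + 1))
        (∑ i ∈ Finset.range (J' + 1), ((F.P Kt).d * (((F.P Kt).L ^ i - 1) / 2) + 1)) ≤
        ∑ i ∈ Finset.range (J + 1 + 1), ((F.P Kt).d * (((F.P Kt).L ^ i - 1) / 2) + 1) :=
      max_le (hℓmono (Nat.le_succ J)) (hℓmono hJ'le)
    have hR : R + 3 ≤ (F.P Kt).L ^ (J - 1) * ν.M₁ := by
      have h := hRad J hJ1 hJk
      omega
    exact Or.inl (boxPlaqs_src_mem_hullD hM hdiv hJ1 hJk hxΩ hR hp)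
  exact exists_gaugeLetterLoc_atRecord_local ν Kt hk0 hk hM2 hdiv Z hN hρn W 𝒞 hD hmin N hGN hN1 hεP hP hSΩ a θ hθ0 ha0 haN hθ ha hδ0 hWj

/-! ## §3 The capstone modulo a graded bound, datum, local region geometry and numerics -/

/-- ★★★ **(σ)_N AT THE RECORD MODULO A GRADED PLAQUETTE BOUND, DATUM, LOCAL REGION GEOMETRY AND NUMERICS** — `N12GaugeLetterLocOfPlaqSmall.exists_gaugeLetterLoc_atRecord_of_plaqSmall_geometry` with
the shadow geometry `hGmem` asked only for members within walk-distance `ℓ_k + m·L^k` of `Ω₁(Z)` (inhabitable from a bounded region box).  RESIDUE: `hmin`, `hU` (free `ε`), `W 𝒞 ρn`, `hGN` ∕ `hN1` ∕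
LOCAL `hGmem`, `θ`, numerics.
[cite: Balaban1985Variational, (2)–(4) p.278, Thm 1 p.280; Balaban1985Averaging, Prop. 2 (52)–(53) p.26; Balaban1988Convergent, (2.12)–(2.13) pp.256–257, (2.16) p.257, p.267] -/
theorem exists_gaugeLetterLoc_atRecord_of_plaqSmall_geometry_local {F : T4Family} (ν : Node00.Stage7Numerics) (Kt : ℕ) {k : ℕ} (hk0 : 0 < k) (hk : k ≤ (F.P Kt).m + (F.P Kt).K)
    (hM2 : 2 ≤ ν.M₁) (hdiv : side (F.P Kt).L ν.M₁ k ∣ (F.P Kt).sitesPerDir 0) (Z : Set (Site (F.P Kt) 0))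
    -- no wrapping, at the caps `ℓ_k`, `m·L^k`
    (hN : 2 * (∑ i ∈ Finset.range (k + 1), ((F.P Kt).d * (((F.P Kt).L ^ i - 1) / 2) + 1)) + 1 +
      (3 * ((F.P Kt).d * (((F.P Kt).L - 1) / 2)) + 5) * (F.P Kt).L ^ k < (F.P Kt).sitesPerDir 0)
    -- radius numerics: the level-`J` box fits the collar `L^{J−1}·M₁`
    (hRad : ∀ J, 1 ≤ J → J ≤ k →
      (2 * ∑ i ∈ Finset.range (J + 1 + 1), ((F.P Kt).d * (((F.P Kt).L ^ i - 1) / 2) + 1)) + 1 +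
          (3 * ((F.P Kt).d * (((F.P Kt).L - 1) / 2)) + 5) * (F.P Kt).L ^ min (J + 1) k +
        (∑ i ∈ Finset.range (J + 1), ((F.P Kt).d * (((F.P Kt).L ^ i - 1) / 2) + 1)) + 3 ≤ (F.P Kt).L ^ (J - 1) * ν.M₁)
    -- the region-normalised datum and the minimiser
    {ρn : ℝ} (hρn : 0 ≤ ρn)
    (W : GaugeField (F.P Kt) k SU2) (𝒞 : Set (PBond (F.P Kt) k)) (hD : ∀ c ∈ 𝒞, dist1 (W c) ≤ ρn)
    {U₀ : GaugeField (F.P Kt) 0 SU2}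
    (hmin : IsMinimizer (Node00.avOfRecord F 2 Kt) (Node00.regMSCoPOfRecord F 2 ν Kt k (maxDomT ν.M₁ Z)) (Bj ν.M₁ Z k)
      (avgFamily (Node00.avOfRecord F 2 Kt) (qsstarGIter0 k W)) U₀)
    -- geometry of the neighbourhood (dag-n12-w6's letters, verbatim)
    (N : Set (PBond (F.P Kt) 0))
    (hGN : ∀ b ∈ N, (b.src ∉ maxDomT ν.M₁ Z 1 ∨ b.tgt ∉ maxDomT ν.M₁ Z 1) → blockIter k b.tgt ≠ blockIter k b.src →
      (⟨blockIter k b.src, b.dir⟩ : PBond (F.P Kt) k) ∈ 𝒞)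
    (hN1 : ∀ p : Plaq (F.P Kt) 0, ((⟨p.src, p.μ⟩ : PBond (F.P Kt) 0) ∈ {b : PBond (F.P Kt) 0 | b.src ∈ maxDomT ν.M₁ Z 1} ∨
        (⟨p.src.shift p.μ, p.ν⟩ : PBond (F.P Kt) 0) ∈ {b : PBond (F.P Kt) 0 | b.src ∈ maxDomT ν.M₁ Z 1} ∨
        (⟨p.src.shift p.ν, p.μ⟩ : PBond (F.P Kt) 0) ∈ {b : PBond (F.P Kt) 0 | b.src ∈ maxDomT ν.M₁ Z 1} ∨
        (⟨p.src, p.ν⟩ : PBond (F.P Kt) 0) ∈ {b : PBond (F.P Kt) 0 | b.src ∈ maxDomT ν.M₁ Z 1}) →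
      (⟨p.src, p.μ⟩ : PBond (F.P Kt) 0) ∈ N ∧ (⟨p.src.shift p.μ, p.ν⟩ : PBond (F.P Kt) 0) ∈ N ∧
        (⟨p.src.shift p.ν, p.μ⟩ : PBond (F.P Kt) 0) ∈ N ∧ (⟨p.src, p.ν⟩ : PBond (F.P Kt) 0) ∈ N)
    -- DISPLAYED: a graded plaquette bound for `U₀` on `{Ω_j}` with a FREE `ε > 0` (class: `ε = εreg`; [15] Thm 1: `ε = B₃·δ̄`), small in Prop. 2's sense at `α₀ := ε·L²`
    {ε : ℝ} (hεpos : 0 < ε)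
    (hU : ∀ j ≤ k, PlaqSmallOn (plaqsOf (Node00.topSeq (Node00.suppDomOfRecord F ν Kt (maxDomT ν.M₁ Z)) (maxDomT ν.M₁ Z) j)) (ε * (F.P Kt).eta j ^ 2) U₀)
    (hα3 : (143 * (((((F.P Kt).d + 4 : ℕ) : ℝ)) ^ 2 / 4) ^ 2) * (ε * (F.P Kt).L ^ 2) ≤ 1 / 3)
    (hα2 : 2 * (ε * (F.P Kt).L ^ 2) ≤ 2 * deltaSU (Fin 2) / ((((F.P Kt).d + 4) * (F.P Kt).L : ℕ) : ℝ) ^ 2)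
    (haN : (((((F.P Kt).d + 2) * (F.P Kt).L : ℕ) : ℝ) ^ 2 / 4) * (2 * (ε * (F.P Kt).L ^ 2)) < deltaSU (Fin 2))
    -- the tower budgets `θ` fed by the constant plaquette bound `a := 2·ε·L²`
    (θ : ℕ → ℝ) (hθ0 : 0 ≤ θ 0)
    (hθ : ∀ j, 6 * ((((((F.P Kt).d + 2) * (F.P Kt).L : ℕ) : ℝ) ^ 2 / 4) * (2 * (ε * (F.P Kt).L ^ 2))) + (F.P Kt).L * θ j ≤ θ (j + 1))
    -- the family's support numerics: `M₁ ≥ ((d+4)L + 6)·L²`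
    (hM₁ : (((F.P Kt).d + 4) * (F.P Kt).L + 6) * (F.P Kt).L ^ 2 ≤ ν.M₁)
    -- GEOMETRY instead of the datum letter: the `k`-shadows of the face-crossing members of `𝐁_k(Z)` lie in `𝒞`
    (hGmem : ∀ x ∈ maxDomT ν.M₁ Z 1, ∀ i ≤ k, ∀ c ∈ bondsOf ((Bj ν.M₁ Z k : DetSet (F.P Kt)) i),
      (∃ w : List (Letter (F.P Kt).d), w.length ≤ (∑ i ∈ Finset.range (k + 1), ((F.P Kt).d * (((F.P Kt).L ^ i - 1) / 2) + 1)) + (3 * ((F.P Kt).d * (((F.P Kt).L - 1) / 2)) + 5) * (F.P Kt).L ^ k ∧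
        (walkEnd x w = embIter i c.src ∨ walkEnd x w = embIter i c.tgt)) →
      blockIter k (embIter i c.tgt) ≠ blockIter k (embIter i c.src) → (⟨blockIter k (embIter i c.src), c.dir⟩ : PBond (F.P Kt) k) ∈ 𝒞) :
    ∃ σ : GaugeTransf (F.P Kt) 0 SU2,
      (∀ j, j ≤ k → ∀ b ∈ bondsOf (Bj ν.M₁ Z k j), toMS σ j b.src = 1 ∧ toMS σ j b.tgt = 1) ∧
        (∀ p : Plaq (F.P Kt) 0, ((⟨p.src, p.μ⟩ : PBond (F.P Kt) 0) ∈ {b : PBond (F.P Kt) 0 | b.src ∈ maxDomT ν.M₁ Z 1} ∨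
            (⟨p.src.shift p.μ, p.ν⟩ : PBond (F.P Kt) 0) ∈ {b : PBond (F.P Kt) 0 | b.src ∈ maxDomT ν.M₁ Z 1} ∨
            (⟨p.src.shift p.ν, p.μ⟩ : PBond (F.P Kt) 0) ∈ {b : PBond (F.P Kt) 0 | b.src ∈ maxDomT ν.M₁ Z 1} ∨
            (⟨p.src, p.ν⟩ : PBond (F.P Kt) 0) ∈ {b : PBond (F.P Kt) 0 | b.src ∈ maxDomT ν.M₁ Z 1}) →
          ‖((gaugeAct σ U₀ ⟨p.src, p.μ⟩ : SU2) : Matrix (Fin 2) (Fin 2) ℂ) - 1‖ ≤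
              max ρn ((((2 * (∑ i ∈ Finset.range (k + 1), ((F.P Kt).d * (((F.P Kt).L ^ i - 1) / 2) + 1)) + 1 +
                  (3 * ((F.P Kt).d * (((F.P Kt).L - 1) / 2)) + 5) * (F.P Kt).L ^ k : ℕ) : ℝ)) ^ 2 / 4 * (ε * (F.P Kt).eta 0 ^ 2) +
                ((3 * ((F.P Kt).d * (((F.P Kt).L - 1) / 2)) + 5 : ℕ) : ℝ) * θ k + ((3 * ((F.P Kt).d * (((F.P Kt).L - 1) / 2)) + 5 : ℕ) : ℝ) * ρn) ∧
            ‖((gaugeAct σ U₀ ⟨p.src.shift p.μ, p.ν⟩ : SU2) : Matrix (Fin 2) (Fin 2) ℂ) - 1‖ ≤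
              max ρn ((((2 * (∑ i ∈ Finset.range (k + 1), ((F.P Kt).d * (((F.P Kt).L ^ i - 1) / 2) + 1)) + 1 +
                  (3 * ((F.P Kt).d * (((F.P Kt).L - 1) / 2)) + 5) * (F.P Kt).L ^ k : ℕ) : ℝ)) ^ 2 / 4 * (ε * (F.P Kt).eta 0 ^ 2) +
                ((3 * ((F.P Kt).d * (((F.P Kt).L - 1) / 2)) + 5 : ℕ) : ℝ) * θ k + ((3 * ((F.P Kt).d * (((F.P Kt).L - 1) / 2)) + 5 : ℕ) : ℝ) * ρn) ∧
            ‖((gaugeAct σ U₀ ⟨p.src.shift p.ν, p.μ⟩ : SU2) : Matrix (Fin 2) (Fin 2) ℂ) - 1‖ ≤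
              max ρn ((((2 * (∑ i ∈ Finset.range (k + 1), ((F.P Kt).d * (((F.P Kt).L ^ i - 1) / 2) + 1)) + 1 +
                  (3 * ((F.P Kt).d * (((F.P Kt).L - 1) / 2)) + 5) * (F.P Kt).L ^ k : ℕ) : ℝ)) ^ 2 / 4 * (ε * (F.P Kt).eta 0 ^ 2) +
                ((3 * ((F.P Kt).d * (((F.P Kt).L - 1) / 2)) + 5 : ℕ) : ℝ) * θ k + ((3 * ((F.P Kt).d * (((F.P Kt).L - 1) / 2)) + 5 : ℕ) : ℝ) * ρn) ∧
            ‖((gaugeAct σ U₀ ⟨p.src, p.ν⟩ : SU2) : Matrix (Fin 2) (Fin 2) ℂ) - 1‖ ≤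
              max ρn ((((2 * (∑ i ∈ Finset.range (k + 1), ((F.P Kt).d * (((F.P Kt).L ^ i - 1) / 2) + 1)) + 1 +
                  (3 * ((F.P Kt).d * (((F.P Kt).L - 1) / 2)) + 5) * (F.P Kt).L ^ k : ℕ) : ℝ)) ^ 2 / 4 * (ε * (F.P Kt).eta 0 ^ 2) +
                ((3 * ((F.P Kt).d * (((F.P Kt).L - 1) / 2)) + 5 : ℕ) : ℝ) * θ k + ((3 * ((F.P Kt).d * (((F.P Kt).L - 1) / 2)) + 5 : ℕ) : ℝ) * ρn)) ∧
        (∀ b ∈ inputs (Bj ν.M₁ Z k), b ∈ N →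
          ‖((gaugeAct σ U₀ b : SU2) : Matrix (Fin 2) (Fin 2) ℂ) - 1‖ ≤
              max ρn ((((2 * (∑ i ∈ Finset.range (k + 1), ((F.P Kt).d * (((F.P Kt).L ^ i - 1) / 2) + 1)) + 1 +
                  (3 * ((F.P Kt).d * (((F.P Kt).L - 1) / 2)) + 5) * (F.P Kt).L ^ k : ℕ) : ℝ)) ^ 2 / 4 * (ε * (F.P Kt).eta 0 ^ 2) +
                ((3 * ((F.P Kt).d * (((F.P Kt).L - 1) / 2)) + 5 : ℕ) : ℝ) * θ k + ((3 * ((F.P Kt).d * (((F.P Kt).L - 1) / 2)) + 5 : ℕ) : ℝ) * ρn)) := by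
  obtain ⟨Sfam, h1, h2, h3⟩ := exists_segmentPlaqFamily_Bj ν Kt hk hM₁ hdiv Z
  have hP0 : PlaqSmallOn (plaqsOf (Node00.suppDomOfRecord F ν Kt (maxDomT ν.M₁ Z))) (ε * (F.P Kt).eta 0 ^ 2) U₀ := hU 0 (Nat.zero_le _)
  have hεP : 0 ≤ ε * (F.P Kt).eta 0 ^ 2 := by unfold Params.eta; positivity
  exact exists_gaugeLetterLoc_atRecord_of_supportSmall_local ν Kt hk0 hk hM2 hdiv Z hN hRad hρn W 𝒞 hD hmin hεP hP0 N hGN hN1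
    (fun _ => 2 * (ε * (F.P Kt).L ^ 2)) θ hθ0 (fun _ => by positivity) (fun j _ => haN) hθ
    (iteratedPlaqLetter_of_family_of_plaqSmall ν Kt Z hεpos hU hα3 hα2 Sfam h1 h2 h3) hρn
    (datumLetter_of_shadows_local Kt hk (Bj ν.M₁ Z k) W hρn hD (maxDomT ν.M₁ Z 1) _ hGmem)

end Summit.QuantumFields.YangMills.BalabanUVNodes.N12GaugeLetterLocOfPlaqSmallLocal

end
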